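import Summits.Ventures.YMGap.RobustBall.BoundaryDecaySummable
import Summits.Ventures.YMGap.RobustBall.PeriodisedBox
import Summits.QuantumFields.BalabanUV.InfraRed.StrongCouplingVarianceDoorSUN
import HarnessLib

/-!
# Venture YMGap, track ROBUST-BALL — ONE STATE AT A RATE, TIER 2 (continued): two boundary fields, every `N` (Bakry–Émery)
# and the `SU(2)` readings of the summable boundary decay

HONEST FRAMING. WHAT THIS IS: a venture file (cell `pub-ymgap`, track Y2 ROBUST-BALL, seat ds-3, theorems only) continuing
`BoundaryDecaySummable.lean` (`abs_boundaryS_sub_integral_le`: every DLR state of a tier-2 member forgets the boundary field at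
the Dobrushin weight rate `t`):
* `abs_boundaryS_sub_boundaryS_le` — two boundary fields on the same volume: `≤ 4√N · K · #Δ · e^{−t D}` (a DLR state exists,
  `perturbedGibbsMeasuresS_nonempty`, and serves as go-between);
* ★ `suN_abs_boundaryS_sub_integral_le_bakryEmery` — EVERY `N ≥ 2`, hypothesis-free with the Bakry–Émery pair
  `(1/(N(1/2−b)), N/(1/2−b))`, `b = 2(d−1)|β| < 1/2`, packaged on `MemBallZdS a Λ_t t W`: row condition
  `6(d−1)|β| e^{a} e^{t}/(1/2 − b) + e^{a/2} Λ_t/√(N(1/2 − b)) < 1`, bound `2√N · K · #Δ · e^{−t D}`;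
* ★ `su2_abs_boundaryS_sub_integral_le` — `SU(2)` with the sharp one-link pair `(c, v) = (2/3, 8/3)`
  (`oneLinkPoincareSUN_two_sharp`, `linVariance_of_poincare`): HYPOTHESIS-FREE under
  `2(d−1)|β_W| e^{a} e^{t} + e^{a/2} √(2/3) Λ_t < 1` (the hypothesis of rb-p1's `su2_perturbedMassGapS`), bound
  `2√2 · K · #Δ · e^{−t D}`;
* ★ `su2_abs_boundaryS_sub_integral_le_of_memBallZdS` — packaged on the tier-2 ball `MemBallZdS a Λ_t t W`;
* ★ `su2_abs_boxS_sub_integral_le_of_memBallZdS` — boxes: observable on `boxLinks d m`, volume `boxLinks d n`, ANY boundary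
  field: `2√2 · K · #Δ · e^{−t (n − m)}` — the thermodynamic limit along boxes at rate `t`, uniformly in the boundary field.
WHAT THIS IS NOT: strong-coupling LATTICE statements inside the tier-2 ball; nothing about the continuum limit or the Clay
Millennium problem.

References: H. Föllmer, LNM 1362 (1988), Ch. I, (2.10), Cor. (2.14); H.-O. Georgii (2011), Remark 8.26; rb-p1's
`SummableMassGap.lean`, `MassGapOnBallS.lean`; the seat's `BoundaryDecaySummable.lean`, `BoundaryDecayBox.lean` (tier 1).
-/

noncomputable section

open MeasureTheory Filter Function ProbabilityTheory Real Topology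
open scoped NNReal
open Literature.Probability.LatticeModels
open Literature.Probability.LatticeModels.DobrushinMetric
open Literature.MathematicalPhysics.QuantumLattice
open Literature.MathematicalPhysics.QuantumFieldTheory hiding ZdEdge
open Summit.QuantumFields.BalabanUV.InfraRed.StrongCouplingPoincareDoorSUN (oneLinkPoincareSUN_two_sharp oneLinkPoincareSUN_bakryEmery)
open Summit.QuantumFields.BalabanUV.InfraRed.StrongCouplingVarianceDoorSUN (oneLinkVarianceBound_bakryEmery)

namespace Summit.Ventures.YMGap.RobustBall

section SUN

variable {d N : ℕ}
variable {W : Potential (ZdEdge d) (Matrix.specialUnitaryGroup (Fin N) ℂ)} {B : Finset (ZdEdge d) → ℝ}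

/-- **Two boundary fields on the same volume, tier 2** (any DLR state as go-between; one exists by `perturbedGibbsMeasuresS_nonempty`):
`|∫ F dγ^{W,S}_Λ(· | η) − ∫ F dγ^{W,S}_Λ(· | η')| ≤ 4√N · K · #Δ · e^{−t D}`. [folklore] -/
theorem abs_boundaryS_sub_boundaryS_le (hd : 1 ≤ d) (hN : 1 ≤ N) {β b c v a Λt t : ℝ}
    (hc : 0 ≤ c) (hv : 0 ≤ v) (hb : |β| * (2 * ((d : ℝ) - 1)) ≤ b)
    (hP : ∀ B : Matrix (Fin N) (Fin N) ℂ, matrixOpNorm B ≤ b →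
      ∀ (ψ : Matrix.specialUnitaryGroup (Fin N) ℂ → ℝ) (M : ℝ), 0 ≤ M →
        (∀ x y, |ψ x - ψ y| ≤ M * suFrobDist x y) →
        Var[ψ; (haarProbability (Matrix.specialUnitaryGroup (Fin N) ℂ)).tilted
          fun g => (N : ℝ) * ((g : Matrix (Fin N) (Fin N) ℂ) * B).trace.re] ≤ c * M ^ 2)
    (hVB : ∀ B : Matrix (Fin N) (Fin N) ℂ, matrixOpNorm B ≤ b → ∀ Δ : Matrix (Fin N) (Fin N) ℂ,
      Var[fun g : Matrix.specialUnitaryGroup (Fin N) ℂ =>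
          (N : ℝ) * ((g : Matrix (Fin N) (Fin N) ℂ) * Δ).trace.re;
        (haarProbability (Matrix.specialUnitaryGroup (Fin N) ℂ)).tilted
          fun g => (N : ℝ) * ((g : Matrix (Fin N) (Fin N) ℂ) * B).trace.re] ≤ v * frobNorm Δ ^ 2)
    (h : IsLinkSummable W B) (hWc : ∀ X, Continuous (W X))
    (hWdep : ∀ X, DependsOn (W X) (↑X : Set (ZdEdge d)))
    {osc : Finset (ZdEdge d) → ZdEdge d → ℝ} (hosc : ∀ X, Dobrushin.IsOscBound (W X) (osc X))
    (hoscs : ∀ e, Summable fun X : Finset (ZdEdge d) => (if e ∈ X then osc X e else 0))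
    (hosca : ∀ e, ∑' X : Finset (ZdEdge d), (if e ∈ X then osc X e else 0) ≤ a)
    {lip : Finset (ZdEdge d) → ZdEdge d → ℝ} (hlip : ∀ X, IsLipBound suFrobDist (W X) (lip X))
    {ℓ : ZdEdge d → ZdEdge d → ℝ}
    (hlips : ∀ e y, Summable fun X : Finset (ZdEdge d) => (if e ∈ X ∧ y ∈ X then lip X y else 0))
    (hℓ : ∀ e y, y ≠ e → ∑' X : Finset (ZdEdge d), (if e ∈ X ∧ y ∈ X then lip X y else 0) ≤ ℓ e y)
    (ht : 0 ≤ t) (hℓs : ∀ e, Summable fun y => (if y = e then 0 else ℓ e y) * exp (t * ‖e.1 - y.1‖))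
    (hℓt : ∀ e, ∑' y, (if y = e then 0 else ℓ e y) * exp (t * ‖e.1 - y.1‖) ≤ Λt)
    (hρ : 6 * ((d : ℝ) - 1) * |β| * (exp a * exp t * Real.sqrt (c * v)) + exp (a / 2) * Real.sqrt c * Λt < 1)
    (Λ : Finset (ZdEdge d)) (η η' : LGConfig d (Matrix.specialUnitaryGroup (Fin N) ℂ))
    {F : LGConfig d (Matrix.specialUnitaryGroup (Fin N) ℂ) → ℝ} {Δ : Finset (ZdEdge d)} {K : ℝ≥0}
    (hF : IsLipschitzCylinder (fundamentalRep (Fin N)) F Δ K) {D : ℝ}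
    (hD : ∀ y ∈ Δ, ∀ z, z ∉ Λ → D ≤ ‖y.1 - z.1‖) :
    |(∫ U, F U ∂(perturbedYMS (d := d) (fundamentalRep (Fin N)) (N * β) W Λ η)) -
        ∫ U, F U ∂(perturbedYMS (d := d) (fundamentalRep (Fin N)) (N * β) W Λ η')| ≤
      4 * Real.sqrt N * K * Δ.card * exp (-(t * D)) := by
  haveI : SecondCountableTopology (Matrix (Fin N) (Fin N) ℂ) :=
    inferInstanceAs (SecondCountableTopology (Fin N → Fin N → ℂ))
  haveI : SecondCountableTopology (Matrix.specialUnitaryGroup (Fin N) ℂ) :=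
    Topology.IsEmbedding.subtypeVal.secondCountableTopology
  obtain ⟨μ, hμ⟩ := perturbedGibbsMeasuresS_nonempty (d := d) (fundamentalRep (Fin N)) (continuous_fundamentalRep (Fin N))
    (N * β) h hWc hWdep
  have h1 := abs_boundaryS_sub_integral_le hd hN hc hv hb hP hVB h hWc hWdep hosc hoscs hosca hlip hlips hℓ ht hℓs hℓt hρ hμ
    Λ η hF hD
  have h2 := abs_boundaryS_sub_integral_le hd hN hc hv hb hP hVB h hWc hWdep hosc hoscs hosca hlip hlips hℓ ht hℓs hℓt hρ hμ
    Λ η' hF hD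
  calc |(∫ U, F U ∂(perturbedYMS (d := d) (fundamentalRep (Fin N)) (N * β) W Λ η)) -
        ∫ U, F U ∂(perturbedYMS (d := d) (fundamentalRep (Fin N)) (N * β) W Λ η')|
      ≤ |(∫ U, F U ∂(perturbedYMS (d := d) (fundamentalRep (Fin N)) (N * β) W Λ η)) - ∫ U, F U ∂μ| +
          |(∫ U, F U ∂(perturbedYMS (d := d) (fundamentalRep (Fin N)) (N * β) W Λ η')) - ∫ U, F U ∂μ| := by
        rw [abs_sub_comm (∫ U, F U ∂(perturbedYMS (d := d) (fundamentalRep (Fin N)) (N * β) W Λ η')) (∫ U, F U ∂μ)]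
        exact abs_sub_le _ _ _
    _ ≤ 2 * Real.sqrt N * K * Δ.card * exp (-(t * D)) + 2 * Real.sqrt N * K * Δ.card * exp (-(t * D)) := add_le_add h1 h2
    _ = 4 * Real.sqrt N * K * Δ.card * exp (-(t * D)) := by ring


/-- ★ **TIER 2, EVERY `N ≥ 2`, HYPOTHESIS-FREE (Bakry–Émery pair), PACKAGED ON THE BALL `MemBallZdS a Λ_t t W`**: with
`b = 2(d−1)|β| < 1/2` ('t Hooft `β`, tree coupling `N β`) and the row condition
`6(d−1)|β| e^{a} e^{t}/(1/2 − b) + e^{a/2} Λ_t/√(N(1/2 − b)) < 1`, every member, every DLR state, every volume, EVERY boundary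
field, every Lipschitz cylinder at depth `≥ D`: `|∫ F dγ^{W,S}_Λ(· | η) − ∫ F dμ| ≤ 2√N · K · #Δ · e^{−t D}`. [folklore] -/
theorem suN_abs_boundaryS_sub_integral_le_bakryEmery (hd : 1 ≤ d) (hN : 2 ≤ N) {β a Λt t : ℝ}
    (hb : |β| * (2 * ((d : ℝ) - 1)) < 1 / 2) (hmem : MemBallZdS a Λt t W) (ht : 0 ≤ t)
    (hρ : 6 * ((d : ℝ) - 1) * |β| * (exp a * exp t) / (1 / 2 - |β| * (2 * ((d : ℝ) - 1))) +
      exp (a / 2) * Λt / Real.sqrt ((N : ℝ) * (1 / 2 - |β| * (2 * ((d : ℝ) - 1)))) < 1)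
    {μ : Measure (LGConfig d (Matrix.specialUnitaryGroup (Fin N) ℂ))}
    (hμ : μ ∈ perturbedGibbsMeasuresS (d := d) (fundamentalRep (Fin N)) (N * β) W)
    (Λ : Finset (ZdEdge d)) (η : LGConfig d (Matrix.specialUnitaryGroup (Fin N) ℂ))
    {F : LGConfig d (Matrix.specialUnitaryGroup (Fin N) ℂ) → ℝ} {Δ : Finset (ZdEdge d)} {K : ℝ≥0}
    (hF : IsLipschitzCylinder (fundamentalRep (Fin N)) F Δ K) {D : ℝ}
    (hD : ∀ y ∈ Δ, ∀ z, z ∉ Λ → D ≤ ‖y.1 - z.1‖) :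
    |(∫ U, F U ∂(perturbedYMS (d := d) (fundamentalRep (Fin N)) (N * β) W Λ η)) - ∫ U, F U ∂μ| ≤
      2 * Real.sqrt N * K * Δ.card * exp (-(t * D)) := by
  obtain ⟨B₀, hB₀⟩ := hmem.summable
  obtain ⟨osc, lip, ℓ, h1, h2, h3, h4, h5, h6, h7, h8⟩ := hmem.loads
  set b : ℝ := |β| * (2 * ((d : ℝ) - 1)) with hbdef
  have hNpos : (0 : ℝ) < N := by exact_mod_cast (show 0 < N by omega)
  have hgap : 0 < 1 / 2 - b := by linarith
  have hP := oneLinkPoincareSUN_bakryEmery hN hb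
  have hV := oneLinkVarianceBound_bakryEmery hN hb
  have hc : (0 : ℝ) ≤ 1 / ((N : ℝ) * (1 / 2 - b)) := by positivity
  have hv : (0 : ℝ) ≤ (N : ℝ) / (1 / 2 - b) := by positivity
  refine abs_boundaryS_sub_integral_le hd (by omega) hc hv le_rfl (fun B hB => hP B hB) (fun B hB => hV B hB)
    hB₀ hmem.continuous hmem.dependsOn h1 h3 h4 h2 h5 h6 ht h7 h8 ?_ hμ Λ η hF hD
  have hsq1 : Real.sqrt (1 / ((N : ℝ) * (1 / 2 - b)) * ((N : ℝ) / (1 / 2 - b))) = 1 / (1 / 2 - b) := by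
    rw [show 1 / ((N : ℝ) * (1 / 2 - b)) * ((N : ℝ) / (1 / 2 - b)) = (1 / (1 / 2 - b)) ^ 2 by field_simp,
      Real.sqrt_sq (by positivity)]
  have hsq2 : Real.sqrt (1 / ((N : ℝ) * (1 / 2 - b))) = 1 / Real.sqrt ((N : ℝ) * (1 / 2 - b)) := by
    rw [Real.sqrt_div' _ (mul_nonneg hNpos.le hgap.le), Real.sqrt_one]
  rw [hsq1, hsq2]
  calc 6 * ((d : ℝ) - 1) * |β| * (exp a * exp t * (1 / (1 / 2 - b))) + exp (a / 2) * (1 / Real.sqrt ((N : ℝ) * (1 / 2 - b))) * Λt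
      = 6 * ((d : ℝ) - 1) * |β| * (exp a * exp t) / (1 / 2 - b) + exp (a / 2) * Λt / Real.sqrt ((N : ℝ) * (1 / 2 - b)) := by
        ring
    _ < 1 := hρ

end SUN

/-! ### `SU(2)` with the sharp one-link pair `(c, v) = (2/3, 8/3)` -/

section SU2

variable {d : ℕ} {W : Potential (ZdEdge d) (Matrix.specialUnitaryGroup (Fin 2) ℂ)} {B : Finset (ZdEdge d) → ℝ}

/-- ★ **TIER 2, `SU(2)`, HYPOTHESIS-FREE**: for a summable link potential with continuous own-link terms, oscillation load `a`,
diagonal-free weighted cross load `Λ_t` (`t ≥ 0`) and Wilson coupling `β_W` ('t Hooft `β = β_W/4`) with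
`2(d−1)|β_W| e^{a} e^{t} + e^{a/2} √(2/3) Λ_t < 1` (the hypothesis of `su2_perturbedMassGapS`): every DLR state of the member,
every finite volume, EVERY boundary field, every Lipschitz cylinder at depth `≥ D`:
`|∫ F dγ^{W,S}_Λ(· | η) − ∫ F dμ| ≤ 2√2 · K · #Δ · e^{−t D}`. [folklore] -/
theorem su2_abs_boundaryS_sub_integral_le (hd : 1 ≤ d) {βW a Λt t : ℝ}
    (h : IsLinkSummable W B) (hWc : ∀ X, Continuous (W X))
    (hWdep : ∀ X, DependsOn (W X) (↑X : Set (ZdEdge d)))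
    {osc : Finset (ZdEdge d) → ZdEdge d → ℝ} (hosc : ∀ X, Dobrushin.IsOscBound (W X) (osc X))
    (hoscs : ∀ e, Summable fun X : Finset (ZdEdge d) => (if e ∈ X then osc X e else 0))
    (hosca : ∀ e, ∑' X : Finset (ZdEdge d), (if e ∈ X then osc X e else 0) ≤ a)
    {lip : Finset (ZdEdge d) → ZdEdge d → ℝ} (hlip : ∀ X, IsLipBound suFrobDist (W X) (lip X))
    {ℓ : ZdEdge d → ZdEdge d → ℝ}
    (hlips : ∀ e y, Summable fun X : Finset (ZdEdge d) => (if e ∈ X ∧ y ∈ X then lip X y else 0))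
    (hℓ : ∀ e y, y ≠ e → ∑' X : Finset (ZdEdge d), (if e ∈ X ∧ y ∈ X then lip X y else 0) ≤ ℓ e y)
    (ht : 0 ≤ t) (hℓs : ∀ e, Summable fun y => (if y = e then 0 else ℓ e y) * exp (t * ‖e.1 - y.1‖))
    (hℓt : ∀ e, ∑' y, (if y = e then 0 else ℓ e y) * exp (t * ‖e.1 - y.1‖) ≤ Λt)
    (hρ : 2 * ((d : ℝ) - 1) * |βW| * (exp a * exp t) + exp (a / 2) * Real.sqrt (2 / 3) * Λt < 1)
    {μ : Measure (LGConfig d (Matrix.specialUnitaryGroup (Fin 2) ℂ))}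
    (hμ : μ ∈ perturbedGibbsMeasuresS (d := d) (fundamentalRep (Fin 2)) ((2 : ℕ) * (βW / 4)) W)
    (Λ : Finset (ZdEdge d)) (η : LGConfig d (Matrix.specialUnitaryGroup (Fin 2) ℂ))
    {F : LGConfig d (Matrix.specialUnitaryGroup (Fin 2) ℂ) → ℝ} {Δ : Finset (ZdEdge d)} {K : ℝ≥0}
    (hF : IsLipschitzCylinder (fundamentalRep (Fin 2)) F Δ K) {D : ℝ}
    (hD : ∀ y ∈ Δ, ∀ z, z ∉ Λ → D ≤ ‖y.1 - z.1‖) :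
    |(∫ U, F U ∂(perturbedYMS (d := d) (fundamentalRep (Fin 2)) ((2 : ℕ) * (βW / 4)) W Λ η)) - ∫ U, F U ∂μ| ≤
      2 * Real.sqrt 2 * K * Δ.card * exp (-(t * D)) := by
  have hc : (0 : ℝ) ≤ 2 / 3 := by norm_num
  have hP : ∀ B : Matrix (Fin 2) (Fin 2) ℂ, matrixOpNorm B ≤ |βW / 4| * (2 * ((d : ℝ) - 1)) →
      ∀ (ψ : Matrix.specialUnitaryGroup (Fin 2) ℂ → ℝ) (M : ℝ), 0 ≤ M →
        (∀ x y, |ψ x - ψ y| ≤ M * suFrobDist x y) →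
        Var[ψ; (haarProbability (Matrix.specialUnitaryGroup (Fin 2) ℂ)).tilted
          fun g => ((2 : ℕ) : ℝ) * ((g : Matrix (Fin 2) (Fin 2) ℂ) * B).trace.re] ≤ 2 / 3 * M ^ 2 :=
    fun B hB ψ M hM hψ => oneLinkPoincareSUN_two_sharp _ B hB ψ M hM hψ
  have hVB := linVariance_of_poincare (N := 2) hP
  have hv : (0 : ℝ) ≤ 2 / 3 * ((2 : ℕ) : ℝ) ^ 2 := by norm_num
  have hsq : Real.sqrt (2 / 3 * (2 / 3 * ((2 : ℕ) : ℝ) ^ 2)) = 4 / 3 := by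
    rw [show (2 / 3 * (2 / 3 * ((2 : ℕ) : ℝ) ^ 2) : ℝ) = (4 / 3) ^ 2 by norm_num, Real.sqrt_sq (by norm_num)]
  have hρ' : 6 * ((d : ℝ) - 1) * |βW / 4| * (exp a * exp t * Real.sqrt (2 / 3 * (2 / 3 * ((2 : ℕ) : ℝ) ^ 2))) +
      exp (a / 2) * Real.sqrt (2 / 3) * Λt < 1 := by
    rw [hsq]
    have e : 6 * ((d : ℝ) - 1) * |βW / 4| * (exp a * exp t * (4 / 3)) = 2 * ((d : ℝ) - 1) * |βW| * (exp a * exp t) := by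
      rw [abs_div, abs_of_pos (by norm_num : (0 : ℝ) < 4)]
      ring
    rw [e]
    exact hρ
  have hmain := abs_boundaryS_sub_integral_le (N := 2) (β := βW / 4) hd (by norm_num) hc hv le_rfl hP hVB h hWc hWdep
    hosc hoscs hosca hlip hlips hℓ ht hℓs hℓt hρ' hμ Λ η hF hD
  have e2 : Real.sqrt ((2 : ℕ) : ℝ) = Real.sqrt 2 := by norm_num
  rw [e2] at hmain
  exact hmain

/-- ★ **TIER 2, `SU(2)`, PACKAGED ON THE BALL `MemBallZdS a Λ_t t W`**: under `2(d−1)|β_W| e^{a} e^{t} + e^{a/2} √(2/3) Λ_t < 1`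
every member of the tier-2 ball, every DLR state, every volume, EVERY boundary field, every Lipschitz cylinder at depth `≥ D`:
`|∫ F dγ^{W,S}_Λ(· | η) − ∫ F dμ| ≤ 2√2 · K · #Δ · e^{−t D}`. [folklore] -/
theorem su2_abs_boundaryS_sub_integral_le_of_memBallZdS (hd : 1 ≤ d) {βW a Λt t : ℝ} (hmem : MemBallZdS a Λt t W)
    (ht : 0 ≤ t) (hρ : 2 * ((d : ℝ) - 1) * |βW| * (exp a * exp t) + exp (a / 2) * Real.sqrt (2 / 3) * Λt < 1)
    {μ : Measure (LGConfig d (Matrix.specialUnitaryGroup (Fin 2) ℂ))}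
    (hμ : μ ∈ perturbedGibbsMeasuresS (d := d) (fundamentalRep (Fin 2)) ((2 : ℕ) * (βW / 4)) W)
    (Λ : Finset (ZdEdge d)) (η : LGConfig d (Matrix.specialUnitaryGroup (Fin 2) ℂ))
    {F : LGConfig d (Matrix.specialUnitaryGroup (Fin 2) ℂ) → ℝ} {Δ : Finset (ZdEdge d)} {K : ℝ≥0}
    (hF : IsLipschitzCylinder (fundamentalRep (Fin 2)) F Δ K) {D : ℝ}
    (hD : ∀ y ∈ Δ, ∀ z, z ∉ Λ → D ≤ ‖y.1 - z.1‖) :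
    |(∫ U, F U ∂(perturbedYMS (d := d) (fundamentalRep (Fin 2)) ((2 : ℕ) * (βW / 4)) W Λ η)) - ∫ U, F U ∂μ| ≤
      2 * Real.sqrt 2 * K * Δ.card * exp (-(t * D)) := by
  obtain ⟨B, hB⟩ := hmem.summable
  obtain ⟨osc, lip, ℓ, h1, h2, h3, h4, h5, h6, h7, h8⟩ := hmem.loads
  exact su2_abs_boundaryS_sub_integral_le hd hB hmem.continuous hmem.dependsOn h1 h3 h4 h2 h5 h6 ht h7 h8 hρ hμ Λ η hF hD


/-- ★ **TIER 2, `SU(2)`, BOXES — the thermodynamic limit along boxes at the rate `t`, UNIFORMLY IN THE BOUNDARY FIELD**: for every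
member of the tier-2 ball under `2(d−1)|β_W| e^{a} e^{t} + e^{a/2} √(2/3) Λ_t < 1`, every DLR state `μ`, every pair of box
sizes `m, n`, EVERY boundary field `η` on `boxLinks d n` and every Lipschitz cylinder on `boxLinks d m`:
`|∫ F dγ^{W,S}_{box n}(· | η) − ∫ F dμ| ≤ 2√2 · K · #Δ · e^{−t (n − m)}`. [folklore] -/
theorem su2_abs_boxS_sub_integral_le_of_memBallZdS (hd : 1 ≤ d) {βW a Λt t : ℝ} (hmem : MemBallZdS a Λt t W)
    (ht : 0 ≤ t) (hρ : 2 * ((d : ℝ) - 1) * |βW| * (exp a * exp t) + exp (a / 2) * Real.sqrt (2 / 3) * Λt < 1)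
    {μ : Measure (LGConfig d (Matrix.specialUnitaryGroup (Fin 2) ℂ))}
    (hμ : μ ∈ perturbedGibbsMeasuresS (d := d) (fundamentalRep (Fin 2)) ((2 : ℕ) * (βW / 4)) W) {m : ℕ} (n : ℕ)
    (η : LGConfig d (Matrix.specialUnitaryGroup (Fin 2) ℂ))
    {F : LGConfig d (Matrix.specialUnitaryGroup (Fin 2) ℂ) → ℝ} {Δ : Finset (ZdEdge d)} {K : ℝ≥0}
    (hF : IsLipschitzCylinder (fundamentalRep (Fin 2)) F Δ K) (hΔ : Δ ⊆ boxLinks d m) :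
    |(∫ U, F U ∂(perturbedYMS (d := d) (fundamentalRep (Fin 2)) ((2 : ℕ) * (βW / 4)) W (boxLinks d n) η)) - ∫ U, F U ∂μ| ≤
      2 * Real.sqrt 2 * K * Δ.card * exp (-(t * ((n : ℝ) - m))) :=
  su2_abs_boundaryS_sub_integral_le_of_memBallZdS hd hmem ht hρ hμ (boxLinks d n) η hF fun y hy z hz => by
    have hy' := hΔ hy
    rw [mem_boxLinks, mem_siteBox_iff_norm] at hy' hz
    have hz' : (n : ℝ) < ‖z.1‖ := lt_of_not_ge hz
    have h := norm_sub_norm_le z.1 y.1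
    rw [norm_sub_rev] at h
    linarith

end SU2

end Summit.Ventures.YMGap.RobustBall

end
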